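import Summits.ABC.IUTFork.Thm311RealLog
import Literature.IUT.LogVolume.UnitLogCyclotomicPrime
import HarnessLib

/-!
# [IUTchIII] Rmk. 1.2.2 (i) log-shell at the place `(ζ_p − 1)` of `ℚ(ζ_p)`: `I_v = (λ²/p^*) · 𝒪_v` EXACTLY

PROOF-ONLY file (theorems, no definitions) of the abc-iut cell (wave-4 prover seat abc-iut-w4-d017, gen 4;
Team R ramified-mover thread — GO «CYCLOTOMIC-P» by abc-iut-c312-15 (R2) 2026-08-26T07:46Z; post-window
(R)-satisfiability depth, NOT part of the 11:30Z line), generalising the `p = 3` instance — abc-iut-w5-d014's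
p429288 and abc-iut-L5-d1's `RamifiedMover.hshell_K3` p429656 (GAP row G-c312-14-1, shell `= 𝒪_v`, `c₀ = 1`) —
to every prime `p`. TAKES NO SIDE on [IUTchIII] Cor. 3.12; classical local analysis (Neukirch II (5.5),
Washington Lemma 1.4) transported to the binder of `Thm311Real`.

For a number field `K` with `IsCyclotomicExtension {p} ℚ K`, `ζ = ζ_p`, and a finite place `v ∋ p` (so
`v = (ζ_p − 1)`, `e = p − 1`, `λ = ζ_p − 1`): abc-iut-c312-5's analytic family `Thm311.Real.analyticLogv K`
(abc-iut-S1's `unitLog` in abc-iut-S7's rescaled completion) has `log_v(𝒪_v^×) = λ²𝒪_v`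
(`Literature.IUT.LogVolume.CyclotomicPrime.logUnits_eq_closedBall_sq`), hence its log-shell
`I_v = (p_v^*)⁻¹ · log_v(𝒪_v^×)` ([IUTchIII] Rmk. 1.2.2 (i); `p_v^* = p` for odd `p`, `= 4` for `p = 2`) is
**`I_v = c₀ • 𝒪_v` with `c₀ = λ²/p^*`** — `shell_analyticLogv_eq_smul_integers_of_isCyclotomic`. The centre has
`ord_v(c₀) = 2 − (p − 1)·ord_p(p^*)`, i.e. `(3 − p)/(p − 1)` in `ord_p`-units for odd `p`: an integer only for
`p = 3` (`c₀ ∼ 1`, the `K₃` files) — for `p ≥ 5` the shell is a NON-RATIONAL multiple of `𝒪_v` (input shape of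
abc-iut-c312-14's ramified mover). No new definitions; no Prop facts; standard axioms.
[cite: NeukirchANT1999, Ch. II Prop. (5.5)]
-/

noncomputable section

open Metric Set NumberField IsDedekindDomain
open scoped Pointwise

namespace Summit.ABC.IUTFork.Thm311.Real.CyclotomicPrime

open Literature.IUT.LogVolume Literature.IUT.LogThetaLattice Literature.NumberTheory.NumberFields
open Literature.IUT.LogVolume.CyclotomicThree Literature.IUT.LogVolume.CyclotomicPrime
open Summit.ABC.IUTFork.Thm311.Real

variable {K : Type} [Field K] [NumberField K]

/-- The residue characteristic (abc-iut-c312-3's `residueChar`) of a finite place containing the prime `p`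
is `p`. [cite: NeukirchANT1999, Ch. I §8] -/
theorem residueChar_eq_of_natPrime_mem (p : ℕ) [hp : Fact p.Prime] (v : HeightOneSpectrum (𝓞 K))
    (hvp : ((p : ℕ) : 𝓞 K) ∈ v.asIdeal) : residueChar K v = p := by
  have hle : Ideal.span {(p : ℤ)} ≤ v.asIdeal.under ℤ := by
    rw [Ideal.span_le, Set.singleton_subset_iff]
    show algebraMap ℤ (𝓞 K) (p : ℤ) ∈ v.asIdeal
    simpa using hvp
  have hmax : (Ideal.span {(p : ℤ)}).IsMaximal :=
    PrincipalIdealRing.isMaximal_of_irreducible (Nat.prime_iff_prime_int.mp hp.out).irreducible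
  have hne : v.asIdeal.under ℤ ≠ ⊤ := Ideal.comap_ne_top _ v.isPrime.ne_top
  haveI : v.asIdeal.LiesOver (Ideal.span {(p : ℤ)}) := ⟨hmax.eq_of_le hne hle⟩
  exact (mem_placesOver_iff_residueChar v).mp ((mem_placesOver_iff v).mpr this)

section Resc

variable (p : ℕ) [hp : Fact p.Prime] [hK : IsCyclotomicExtension {p} ℚ K] {ζ : K} (hζ : IsPrimitiveRoot ζ p)
variable (v : HeightOneSpectrum (𝓞 K)) (hvp : ((p : ℕ) : 𝓞 K) ∈ v.asIdeal)

include hζ in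
/-- In the rescaled completion at `(ζ_p − 1)`: `log u ∈ λ² · {‖w‖ ≤ 1}` for every unit `u`
(`norm_unitLog_le_norm_sq`). [cite: NeukirchANT1999, Ch. II Prop. (5.5)] -/
theorem exists_unitLog_eq_sq_mul (u : RescaledCompletion K p v hvp) (hu : ‖u‖ = 1) :
    ∃ w : RescaledCompletion K p v hvp, ‖w‖ ≤ 1 ∧
      unitLog u = (RescaledCompletion.of K p v hvp (algebraMap K (v.adicCompletion K) ζ) - 1) ^ 2 * w := by
  have hv := asIdeal_eq_span_zeta_sub_one_of_mem hζ v hvp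
  set lam := RescaledCompletion.of K p v hvp (algebraMap K (v.adicCompletion K) ζ) - 1 with hlam
  have hlam0 : lam ≠ 0 := by
    have h := norm_zeta_sub_one_pow p v hvp hζ
    rw [← hlam] at h
    intro h0
    rw [h0, norm_zero, zero_pow (by have := hp.out.two_le; omega)] at h
    exact (inv_ne_zero (by exact_mod_cast hp.out.ne_zero)) h.symm
  have hb := norm_unitLog_le_norm_sq p v hvp hζ hv u hu
  rw [← hlam] at hb
  refine ⟨unitLog u / lam ^ 2, ?_, by field_simp⟩
  rw [norm_div, norm_pow, div_le_one (by positivity)]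
  exact hb

include hζ in
/-- Conversely every `λ² · w`, `‖w‖ ≤ 1`, is `log u` for a unit `u` (`logUnits_eq_closedBall_sq`, abc-iut-S1's
successive approximation). [cite: NeukirchANT1999, Ch. II Prop. (5.5)] -/
theorem exists_unit_unitLog_eq_sq_mul (w : RescaledCompletion K p v hvp) (hw : ‖w‖ ≤ 1) :
    ∃ u : RescaledCompletion K p v hvp, ‖u‖ = 1 ∧
      unitLog u = (RescaledCompletion.of K p v hvp (algebraMap K (v.adicCompletion K) ζ) - 1) ^ 2 * w := by
  have hv := asIdeal_eq_span_zeta_sub_one_of_mem hζ v hvp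
  have hmem : (RescaledCompletion.of K p v hvp (algebraMap K (v.adicCompletion K) ζ) - 1) ^ 2 * w ∈
      logUnits (RescaledCompletion K p v hvp) := by
    rw [logUnits_eq_closedBall_sq p v hvp hζ hv, mem_closedBall, dist_zero_right, norm_mul, norm_pow]
    calc _ ≤ ‖RescaledCompletion.of K p v hvp (algebraMap K (v.adicCompletion K) ζ) - 1‖ ^ 2 * 1 := by gcongr
      _ = _ := mul_one _
  obtain ⟨u, hu, hlog⟩ := (mem_logUnits_iff).mp hmem
  exact ⟨u, hu, hlog⟩

end Resc

section Transport

variable (p : ℕ) [hp : Fact p.Prime] [hK : IsCyclotomicExtension {p} ℚ K] {ζ : K} (hζ : IsPrimitiveRoot ζ p)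
variable (v : HeightOneSpectrum (𝓞 K)) (hvp : ((p : ℕ) : 𝓞 K) ∈ v.asIdeal)

include hζ in
/-- Transport, units → shell: `(p^*)⁻¹ · log_v(x) ∈ (λ²/p^*) · 𝒪_v` for every unit `x` of `𝒪_v` (read back in
`K_v` along abc-iut-S7's `RescaledCompletion.of`). [cite: NeukirchANT1999, Ch. II Prop. (5.5)] -/
theorem inv_pStar_mul_unitLog_mem_smul (x : (↥(v.adicCompletionIntegers K))ˣ) :
    ((pStar p : ℕ) : v.adicCompletion K)⁻¹ *
      (RescaledCompletion.of K p v hvp).symm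
        (unitLog (RescaledCompletion.of K p v hvp (((x : ↥(v.adicCompletionIntegers K)) : v.adicCompletion K)))) ∈
      (algebraMap K (v.adicCompletion K) ((ζ - 1) ^ 2 / (pStar p : K))) •
        ((v.adicCompletionIntegers K : ValuationSubring (v.adicCompletion K)) : Set (v.adicCompletion K)) := by
  set e := RescaledCompletion.of K p v hvp with he
  have hc : (algebraMap K (v.adicCompletion K) ((ζ - 1) ^ 2 / (pStar p : K))) =
      ((pStar p : ℕ) : v.adicCompletion K)⁻¹ * e.symm ((e (algebraMap K (v.adicCompletion K) ζ) - 1) ^ 2) := by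
    rw [map_div₀, map_natCast, map_pow, map_sub, map_one, div_eq_inv_mul]
    rfl
  have hu : ‖e (((x : ↥(v.adicCompletionIntegers K)) : v.adicCompletion K))‖ = 1 :=
    norm_of_coe_unit_adicCompletionIntegers K p v hvp x
  obtain ⟨w, hw, hlog⟩ := exists_unitLog_eq_sq_mul p hζ v hvp _ hu
  have hmem : e.symm w ∈ ((v.adicCompletionIntegers K : ValuationSubring (v.adicCompletion K)) :
      Set (v.adicCompletion K)) :=
    (mem_integers_iff_norm_rescaled_le_one K p v hvp _).mpr hw
  have heq : ((pStar p : ℕ) : v.adicCompletion K)⁻¹ *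
      e.symm (unitLog (e (((x : ↥(v.adicCompletionIntegers K)) : v.adicCompletion K)))) =
        (algebraMap K (v.adicCompletion K) ((ζ - 1) ^ 2 / (pStar p : K))) • e.symm w := by
    rw [smul_eq_mul, hc, hlog, map_mul, mul_assoc]
  rw [heq]
  exact Set.smul_mem_smul_set hmem

include hζ in
/-- Transport, shell → units: every element of `(λ²/p^*) · 𝒪_v` is `(p^*)⁻¹ · log_v(x)` for a unit `x` of `𝒪_v`.
[cite: NeukirchANT1999, Ch. II Prop. (5.5)] -/
theorem exists_unit_smul_eq_inv_pStar_mul_unitLog (y : v.adicCompletion K)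
    (hy : y ∈ ((v.adicCompletionIntegers K : ValuationSubring (v.adicCompletion K)) : Set (v.adicCompletion K))) :
    ∃ x : (↥(v.adicCompletionIntegers K))ˣ,
      (algebraMap K (v.adicCompletion K) ((ζ - 1) ^ 2 / (pStar p : K))) • y =
        ((pStar p : ℕ) : v.adicCompletion K)⁻¹ *
          (RescaledCompletion.of K p v hvp).symm
            (unitLog (RescaledCompletion.of K p v hvp (((x : ↥(v.adicCompletionIntegers K)) : v.adicCompletion K)))) := by
  set e := RescaledCompletion.of K p v hvp with he
  have hc : (algebraMap K (v.adicCompletion K) ((ζ - 1) ^ 2 / (pStar p : K))) =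
      ((pStar p : ℕ) : v.adicCompletion K)⁻¹ * e.symm ((e (algebraMap K (v.adicCompletion K) ζ) - 1) ^ 2) := by
    rw [map_div₀, map_natCast, map_pow, map_sub, map_one, div_eq_inv_mul]
    rfl
  have hw : ‖e y‖ ≤ 1 := (mem_integers_iff_norm_rescaled_le_one K p v hvp _).mp hy
  obtain ⟨u, hu, hlog⟩ := exists_unit_unitLog_eq_sq_mul p hζ v hvp _ hw
  -- `u` is a unit of `𝒪_v`
  have hval : Valued.v (e.symm u) = 1 := by
    have h1 : ‖u‖ ≤ 1 := hu.le
    have h2 : 1 ≤ ‖u‖ := hu.ge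
    rw [Valued.toNormedField.norm_le_one_iff] at h1
    rw [Valued.toNormedField.one_le_norm_iff] at h2
    exact le_antisymm h1 h2
  have hmem : e.symm u ∈ v.adicCompletionIntegers K := le_of_eq hval
  have hunit : IsUnit (⟨e.symm u, hmem⟩ : v.adicCompletionIntegers K) :=
    HeightOneSpectrum.adicCompletionIntegers.isUnit_iff_valued_eq_one.mpr hval
  obtain ⟨x, hx⟩ := hunit
  refine ⟨x, ?_⟩
  have hxe : e (((x : ↥(v.adicCompletionIntegers K)) : v.adicCompletion K)) = u := by
    rw [hx]; exact e.apply_symm_apply u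
  rw [smul_eq_mul, hc, hxe, hlog, map_mul, mul_assoc, e.symm_apply_apply]

end Transport

/-- **`I_v = (λ²/p^*) · 𝒪_v`** for the analytic `p_v`-adic logarithms (`Thm311.Real.analyticLogv`) at every
finite place `v ∋ p` of a `{p}`-cyclotomic number field `K` (`λ = ζ_p − 1`; `p^* =` abc-iut-L6-t3's `pStar`).
The right-hand side is written on `v.adicCompletion K` (= `Carrier (.inr v)` definitionally).
[cite: NeukirchANT1999, Ch. II Prop. (5.5)] -/
theorem shell_analyticLogv_eq_smul_integers_of_isCyclotomic (p : ℕ) [hp : Fact p.Prime]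
    [hK : IsCyclotomicExtension {p} ℚ K] {ζ : K} (hζ : IsPrimitiveRoot ζ p)
    (v : HeightOneSpectrum (𝓞 K)) (hvp : ((p : ℕ) : 𝓞 K) ∈ v.asIdeal) :
    shell (analyticLogv K) (.inr v) =
      (algebraMap K (v.adicCompletion K) ((ζ - 1) ^ 2 / (pStar p : K))) •
        ((v.adicCompletionIntegers K : ValuationSubring (v.adicCompletion K)) : Set (v.adicCompletion K)) := by
  have hres : residueChar K v = p := residueChar_eq_of_natPrime_mem p v hvp
  subst hres
  refine Set.Subset.antisymm ?_ ?_
  · intro a ha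
    rw [shell_inr] at ha
    obtain ⟨x, rfl⟩ := ha
    rw [analyticLogv_apply]
    exact inv_pStar_mul_unitLog_mem_smul (residueChar K v) hζ v (natCast_residueChar_mem K v) x
  · intro a ha
    obtain ⟨y, hy, hya⟩ :=
      (Set.mem_smul_set (α := v.adicCompletion K) (β := v.adicCompletion K)).mp ha
    obtain ⟨x, hx⟩ :=
      exists_unit_smul_eq_inv_pStar_mul_unitLog (residueChar K v) hζ v (natCast_residueChar_mem K v) y hy
    rw [shell_inr]
    refine ⟨x, ?_⟩
    rw [analyticLogv_apply]
    exact hya.symm.trans hx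

/-- **The G-c312-14-1 shape for every cyclotomic prime**: at every finite place `v ∋ p` of a `{p}`-cyclotomic
number field there is a law-abiding family of `p_v`-adic logarithms (`Thm311.Real.PadicLogs K`,
`Thm311.Real.LogvLaw`) whose shell is `c₀ • 𝒪_v` with `c₀ = λ²/p^* ≠ 0` (the analytic family).
[cite: NeukirchANT1999, Ch. II Prop. (5.5)] -/
theorem exists_padicLogs_logvLaw_shell_eq_smul_integers_of_isCyclotomic (p : ℕ) [hp : Fact p.Prime]
    [hK : IsCyclotomicExtension {p} ℚ K] {ζ : K} (hζ : IsPrimitiveRoot ζ p)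
    (v : HeightOneSpectrum (𝓞 K)) (hvp : ((p : ℕ) : 𝓞 K) ∈ v.asIdeal) :
    ∃ logv : PadicLogs K, LogvLaw logv ∧ ∃ c₀ : Carrier (.inr v : Place K), c₀ ≠ 0 ∧
      shell logv (.inr v) =
        c₀ • ((integers v : ValuationSubring (Carrier (.inr v : Place K))) : Set (Carrier (.inr v : Place K))) := by
  refine ⟨analyticLogv K, logvLaw_analyticLogv K,
    (algebraMap K (v.adicCompletion K) ((ζ - 1) ^ 2 / (pStar p : K)) : Carrier (.inr v : Place K)), ?_,
    shell_analyticLogv_eq_smul_integers_of_isCyclotomic p hζ v hvp⟩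
  have hζ1 : ζ - 1 ≠ 0 := sub_ne_zero.mpr (hζ.ne_one hp.out.one_lt)
  have hpS : (pStar p : K) ≠ 0 := Nat.cast_ne_zero.mpr (pStar_ne_zero hp.out.ne_zero)
  have hK0 : (ζ - 1) ^ 2 / (pStar p : K) ≠ 0 := div_ne_zero (pow_ne_zero 2 hζ1) hpS
  exact (map_ne_zero (algebraMap K (v.adicCompletion K))).mpr hK0

/-! ## The valuation of the centre: `ord_v(c₀) = p − 3` (the mover's parity input) -/

/-- **`ord_v(λ²/p) = −(p − 3)`·(that of a uniformizer)**, i.e. `v(c₀) = exp(p − 3)` in `ℤᵐ⁰`, for odd `p` (where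
`p^* = p`): `v(ζ_p − 1) = exp(−1)` (Mathlib `intValuation_singleton` at `v = (ζ_p − 1)`) and `v(p) = exp(−(p−1))`
(`(ζ_p − 1)^{p−1} ~ p`, Mathlib `IsCyclotomicExtension.Rat.associated_zeta_sub_one_pow_prime`). Since rational
numbers have `ord_v ∈ (p − 1)ℤ`, the centre is a rational multiple of a unit iff `(p − 1) ∣ (p − 3)` iff `p ≤ 3`.
[cite: NeukirchANT1999, Ch. I Lemma (10.1)] -/
theorem valued_center_eq_exp (p : ℕ) [hp : Fact p.Prime] (hp2 : p ≠ 2)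
    [hK : IsCyclotomicExtension {p} ℚ K] {ζ : K} (hζ : IsPrimitiveRoot ζ p)
    (v : HeightOneSpectrum (𝓞 K)) (hvp : ((p : ℕ) : 𝓞 K) ∈ v.asIdeal) :
    Valued.v (algebraMap K (v.adicCompletion K) ((ζ - 1) ^ 2 / (pStar p : K))) =
      WithZero.exp ((p : ℤ) - 3) := by
  have hv := asIdeal_eq_span_zeta_sub_one_of_mem hζ v hvp
  have hodd : Odd p := hp.out.odd_of_ne_two hp2
  have hpS : pStar p = p := pStar_of_odd hodd
  have hne0 : hζ.toInteger - 1 ≠ 0 := by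
    intro h
    have : (hζ.toInteger : K) = 1 := by
      have := congrArg (fun x : 𝓞 K => (x : K)) (sub_eq_zero.mp h); simpa using this
    exact hζ.ne_one hp.out.one_lt (by simpa [IsPrimitiveRoot.coe_toInteger] using this)
  -- valuation of an algebraic integer in the completion
  have hval : ∀ r : 𝓞 K, Valued.v (algebraMap K (v.adicCompletion K) (r : K)) = v.intValuation r := by
    intro r
    show Valued.v (((r : K)) : v.adicCompletion K) = _
    rw [HeightOneSpectrum.valuedAdicCompletion_eq_valuation', RingOfIntegers.coe_eq_algebraMap,
      HeightOneSpectrum.valuation_of_algebraMap]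
  -- `v(ζ - 1) = exp(-1)`
  have h1 : Valued.v (algebraMap K (v.adicCompletion K) (ζ - 1)) = WithZero.exp (-1 : ℤ) := by
    have : (ζ - 1 : K) = ((hζ.toInteger - 1 : 𝓞 K) : K) := by
      rw [RingOfIntegers.coe_eq_algebraMap, map_sub, map_one]; rfl
    rw [this, hval, HeightOneSpectrum.intValuation_singleton v hne0 hv]
  -- `v(p) = exp(-(p-1))`
  have h2 : Valued.v (algebraMap K (v.adicCompletion K) (p : K)) = WithZero.exp (-((p - 1 : ℕ) : ℤ)) := by
    obtain ⟨u, hu⟩ := IsCyclotomicExtension.Rat.associated_zeta_sub_one_pow_prime p hζ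
    have hK : (p : K) = (((hζ.toInteger - 1) ^ (p - 1) * (u : 𝓞 K) : 𝓞 K) : K) := by
      rw [hu]; simp
    have hu1 : v.intValuation (u : 𝓞 K) = 1 := by
      rw [HeightOneSpectrum.intValuation_eq_one_iff]
      intro hmem
      exact v.isPrime.ne_top (Ideal.eq_top_of_isUnit_mem _ hmem u.isUnit)
    rw [hK, hval, map_mul, map_pow, hu1, mul_one, HeightOneSpectrum.intValuation_singleton v hne0 hv,
      ← WithZero.exp_nsmul, nsmul_eq_mul, mul_neg, mul_one]
  rw [hpS, map_div₀, map_pow, Valuation.map_div, Valuation.map_pow, h1, h2, ← WithZero.exp_nsmul,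
    ← WithZero.exp_sub]
  congr 1
  have hp1 : 1 ≤ p := hp.out.one_lt.le
  push_cast [Nat.cast_sub hp1]
  ring

end Summit.ABC.IUTFork.Thm311.Real.CyclotomicPrime

end
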